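import Summits.Ventures.CertifiedArithmetic.LowPrec.SRCoupledBlockError
import HarnessLib

/-!
# Stochastic rounding in low-precision formats LXV — ONE RANDOM DRAW PER BLOCK (iv): THE PREFIX SCAN
# NEVER LOSES TO INDEPENDENT SR ON THE BLOCK SUM — `E e² ≤ ∑ Gᵢ²θᵢ(1−θᵢ)` for sorted gaps, on top of
# the `n`-free law `E e² ≤ G₀²/4` of file LXIII

HONEST FRAMING: certified error envelopes and provably optimal rounding/accumulation schemes for
low-precision formats under stated cost models; every table by two implementations; no hardware or
vendor claims.

Setting of files LXII–LXIV (`LowPrec/SRCoupledBlock`, `…BlockError`, `…CoupledOptimal`): a block of `n`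
values on the `N`-bit residual grid (`θᵢ = tᵢ/m`, `m = 2^N`, gaps `Gᵢ`), all roundings driven by ONE
uniform draw `R < m` through the prefix scan; `e(R) = ∑ Gᵢ(Bᵢ(R) − θᵢ)` the block-sum error,
`Dₖ(R) = ⌊(Cₖ+R)/m⌋ − Cₖ/m` the prefix discrepancies, `rₖ = Cₖ mod m`.
1. JOINT LAW OF TWO PREFIX DISCREPANCIES (`disc_eq_indicator`, `sum_disc_mul_disc`): `Dₖ(R) =
   [R ≥ m − rₖ] − rₖ/m`, so the `Dₖ` are COMONOTONE functions of the one draw and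
   `∑_R DₖDₗ = min(rₖ,rₗ) − rₖrₗ/m`; consequently (`sum_disc_mul_disc_le_sq`) `∑_R DₖDₗ ≤ ∑_R Dₖ²`
   for either index: a cross moment never exceeds the smaller of the two second moments.
2. SUBADDITIVITY OF THE FLOOR VARIANCE (`mod_step_le`, `modvar_le_sum`): `r ↦ r(m−r)` satisfies
   `r′(m−r′) ≤ r(m−r) + t(m−t)` for `r′ = (r+t) mod m`, hence `rₖ(m−rₖ) ≤ ∑_{i<k} tᵢ(m−tᵢ)`: the
   prefix-scan count of every prefix has variance at most that of independent SR (an elementary proof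
   of the count case of file LXIV `sys_optimal_dconvex`, without laws).
3. DOMINANCE (`sum_blockErr_sq_le_indep`): for gaps NON-INCREASING along the block and nonnegative,
   `∑_R e(R)² ≤ m·∑ᵢ Gᵢ²θᵢ(1−θᵢ)`, i.e. `E e² ≤ V_ind := ∑ Gᵢ²θᵢ(1−θᵢ)` = the block-sum MSE of
   independent SR (file LXIV `law_err_sq` / `uncorrelated_mse_eq`).  Proof: Abel form `e = ∑ aₖDₖ`,
   `aₖ ≥ 0` (file LXIII); `E e² = ∑ₖₗ aₖaₗ E DₖDₗ ≤ ∑ₖₗ aₖaₗ V_{min(k,l)}` by 1–2 with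
   `Vₖ = ∑_{i<k} θᵢ(1−θᵢ)`; and `∑ₖₗ aₖaₗV_{min(k,l)} = ∑ᵢ θᵢ(1−θᵢ)(∑_{k>i} aₖ)² = ∑ᵢ Gᵢ²θᵢ(1−θᵢ)`
   (`double_sum_indicator`, telescoping `sum_indicator_gx`).  Together with file LXIII:
   `E e² ≤ min(G₀²/4, V_ind)` — ONE SHARED DRAW IS NEVER WORSE THAN `n` INDEPENDENT DRAWS ON THE BLOCK
   SUM, and is `n`-free.
4. FP4 LEDGER (`FP4.dominance_witness`): the E2M1 block of file LXIII (`(11/2, 13/4, 5/2, 9/8)`, `N = 2`):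
   `∑_R e² = 43/16 ≤ 79/16 = 4·V_ind` (ratio `43/79`); near-tightness: gaps `(4, 1/16, 1/16)` at
   `θ ≡ 1/2`, `N = 1` give `E e² = 4` against `V_ind = 4 + 1/512` (ratio `2048/2049`, the extreme of the
   exhaustive gen13 certificate over 34 821 FP4/FP6 blocks, on all of which the inequality is strict).
NOT CLAIMED: strictness in general; unsorted gaps (the Abel weights change sign and 3 can fail); other
functionals (file LXIV: for signed sums independent SR is minimax).
Prior art: negative dependence of systematic / dependent-rounding samples is classical for EQUAL weights
([Madow1949]; [DoerrEtAl2006, Thm. 3] gives discrepancy `< 1` on intervals, not second moments); the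
weighted second-moment domination 3 for sorted gaps is new as far as searched (FRESHNESS-SR K).
-/

namespace Summit.Ventures.CertifiedArithmetic.LowPrec.SR

open Finset

namespace Coupled

section Value

variable {K : Type*} [Field K] [LinearOrder K] [IsStrictOrderedRing K]

/-! ### Indicators of the one draw -/

omit [LinearOrder K] [IsStrictOrderedRing K] in
/-- `#{R < m : c ≤ R} = m − c` for `c ≤ m`, as a field sum of indicators. -/
theorem sum_indicator_ge {m c : ℕ} (hc : c ≤ m) :
    ∑ R ∈ range m, (if c ≤ R then (1 : K) else 0) = ((m - c : ℕ) : K) := by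
  have _hc := hc
  rw [Finset.sum_boole]
  have hf : (range m).filter (fun R => c ≤ R) = Ico c m := by
    ext R
    simp only [mem_filter, mem_range, mem_Ico]
    omega
  rw [hf, Nat.card_Ico]

omit [LinearOrder K] [IsStrictOrderedRing K] in
/-- Product of two threshold indicators of the same draw = indicator of the larger threshold. -/
theorem ite_mul_ite_indicator (c d R : ℕ) :
    (if c ≤ R then (1 : K) else 0) * (if d ≤ R then 1 else 0) = if max c d ≤ R then 1 else 0 := by
  by_cases hc : c ≤ R <;> by_cases hd : d ≤ R <;> simp [hc, hd]

/-- **Prefix discrepancy as a threshold indicator**: `Dₖ(R) = [m − rₖ ≤ R] − rₖ/m` (`R < m`). -/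
theorem disc_eq_indicator {m R : ℕ} (hm : 0 < m) (hR : R < m) (t : ℕ → ℕ) (k : ℕ) :
    disc K m t R k
      = (if m - pre t k % m ≤ R then (1 : K) else 0) - ((pre t k % m : ℕ) : K) / m := by
  have hm' : (m : K) ≠ 0 := by exact_mod_cast hm.ne'
  have hr : pre t k % m < m := Nat.mod_lt _ hm
  rw [disc_eq_ite hm hR t k]
  by_cases h : m ≤ pre t k % m + R
  · rw [if_pos h, if_pos (by omega), sub_div, div_self hm']
  · rw [if_neg h, if_neg (by omega)]
    ring

/-- **Joint second moments of the prefix discrepancies**: `∑_R DₖDₗ = min(rₖ,rₗ) − rₖrₗ/m`. -/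
theorem sum_disc_mul_disc {m : ℕ} (hm : 0 < m) (t : ℕ → ℕ) (k l : ℕ) :
    ∑ R ∈ range m, disc K m t R k * disc K m t R l
      = ((min (pre t k % m) (pre t l % m) : ℕ) : K)
        - ((pre t k % m : ℕ) : K) * ((pre t l % m : ℕ) : K) / m := by
  have hm' : (m : K) ≠ 0 := by exact_mod_cast hm.ne'
  have hr : pre t k % m < m := Nat.mod_lt _ hm
  have hs : pre t l % m < m := Nat.mod_lt _ hm
  rw [sum_congr rfl fun R hR => by
    rw [disc_eq_indicator hm (mem_range.mp hR) t k, disc_eq_indicator hm (mem_range.mp hR) t l]]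
  have e : ∀ R : ℕ,
      ((if m - pre t k % m ≤ R then (1 : K) else 0) - ((pre t k % m : ℕ) : K) / m)
        * ((if m - pre t l % m ≤ R then (1 : K) else 0) - ((pre t l % m : ℕ) : K) / m)
      = (if max (m - pre t k % m) (m - pre t l % m) ≤ R then (1 : K) else 0)
        - ((pre t l % m : ℕ) : K) / m * (if m - pre t k % m ≤ R then (1 : K) else 0)
        - ((pre t k % m : ℕ) : K) / m * (if m - pre t l % m ≤ R then (1 : K) else 0)
        + ((pre t k % m : ℕ) : K) / m * (((pre t l % m : ℕ) : K) / m) := by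
    intro R
    rw [← ite_mul_ite_indicator]
    ring
  simp_rw [e]
  rw [sum_add_distrib, sum_sub_distrib, sum_sub_distrib, ← mul_sum, ← mul_sum,
    sum_indicator_ge (by omega : max (m - pre t k % m) (m - pre t l % m) ≤ m),
    sum_indicator_ge (Nat.sub_le _ _), sum_indicator_ge (Nat.sub_le _ _), sum_const, card_range,
    nsmul_eq_mul]
  have h2 : m - (m - pre t k % m) = pre t k % m := by omega
  have h3 : m - (m - pre t l % m) = pre t l % m := by omega
  rcases le_total (pre t k % m) (pre t l % m) with h | h
  · have h1 : m - max (m - pre t k % m) (m - pre t l % m) = pre t k % m := by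
      rw [max_eq_left (Nat.sub_le_sub_left h m)]; omega
    rw [h1, h2, h3, min_eq_left h]
    field_simp
    ring
  · have h1 : m - max (m - pre t k % m) (m - pre t l % m) = pre t l % m := by
      rw [max_eq_right (Nat.sub_le_sub_left h m)]; omega
    rw [h1, h2, h3, min_eq_right h]
    field_simp
    ring

/-- **A cross moment never exceeds a second moment**: `∑_R DₖDₗ ≤ ∑_R Dₖ²` (and, by symmetry,
`≤ ∑_R Dₗ²`) — comonotone indicators of one draw. -/
theorem sum_disc_mul_disc_le_sq {m : ℕ} (hm : 0 < m) (t : ℕ → ℕ) (k l : ℕ) :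
    ∑ R ∈ range m, disc K m t R k * disc K m t R l ≤ ∑ R ∈ range m, (disc K m t R k) ^ 2 := by
  have hm' : (0 : K) < m := by exact_mod_cast hm
  have hrK : ((pre t k % m : ℕ) : K) < m := by exact_mod_cast Nat.mod_lt _ hm
  rw [sum_disc_mul_disc hm, sum_disc_sq hm, ← sub_nonpos]
  have key : ((min (pre t k % m) (pre t l % m) : ℕ) : K)
      - ((pre t k % m : ℕ) : K) * ((pre t l % m : ℕ) : K) / m
      - ((pre t k % m : ℕ) : K) * ((m : K) - (pre t k % m : ℕ)) / m
      = ((m : K) * ((min (pre t k % m) (pre t l % m) : ℕ) : K)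
          - ((pre t k % m : ℕ) : K) * ((pre t l % m : ℕ) : K)
          - ((pre t k % m : ℕ) : K) * ((m : K) - (pre t k % m : ℕ))) / m := by
    field_simp
  rw [key]
  refine div_nonpos_of_nonpos_of_nonneg ?_ hm'.le
  rcases le_total (pre t k % m) (pre t l % m) with h | h
  · rw [min_eq_left h]
    have hK : ((pre t k % m : ℕ) : K) ≤ ((pre t l % m : ℕ) : K) := by exact_mod_cast h
    nlinarith [mul_le_mul_of_nonneg_left hK (Nat.cast_nonneg (pre t k % m) : (0 : K) ≤ _)]
  · rw [min_eq_right h]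
    have hK : ((pre t l % m : ℕ) : K) ≤ ((pre t k % m : ℕ) : K) := by exact_mod_cast h
    nlinarith [mul_nonneg (sub_nonneg.mpr hK) (sub_nonneg.mpr hrK.le)]

/-! ### Subadditivity of the floor variance -/

/-- `r′(m − r′) ≤ r(m − r) + t(m − t)` for `r′ = (r + t) mod m`, `r < m`, `t ≤ m`. -/
theorem mod_step_le {m r t : ℕ} (hr : r < m) (ht : t ≤ m) :
    (((r + t) % m : ℕ) : K) * ((m : K) - ((r + t) % m : ℕ))
      ≤ (r : K) * ((m : K) - r) + (t : K) * ((m : K) - t) := by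
  by_cases h : r + t < m
  · rw [Nat.mod_eq_of_lt h]
    push_cast
    nlinarith [mul_nonneg (Nat.cast_nonneg r : (0 : K) ≤ r) (Nat.cast_nonneg t : (0 : K) ≤ t)]
  · have h' : m ≤ r + t := Nat.le_of_not_lt h
    have hlt : r + t - m < m := by omega
    rw [Nat.mod_eq_sub_mod h', Nat.mod_eq_of_lt hlt]
    push_cast [Nat.cast_sub h']
    have hr' : (r : K) < m := by exact_mod_cast hr
    have ht' : (t : K) ≤ m := by exact_mod_cast ht
    nlinarith [mul_nonneg (sub_nonneg.mpr hr'.le) (sub_nonneg.mpr ht')]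

/-- **The prefix-scan count of every prefix has at most the independent-SR variance**:
`rₖ(m − rₖ) ≤ ∑_{i<k} tᵢ(m − tᵢ)` (divide by `m²`: `φₖ(1−φₖ) ≤ ∑_{i<k} θᵢ(1−θᵢ)`). -/
theorem modvar_le_sum {m : ℕ} (hm : 0 < m) {t : ℕ → ℕ} (ht : ∀ i, t i ≤ m) (k : ℕ) :
    ((pre t k % m : ℕ) : K) * ((m : K) - (pre t k % m : ℕ))
      ≤ ∑ i ∈ range k, (t i : K) * ((m : K) - t i) := by
  induction k with
  | zero => simp [pre_zero]
  | succ k ih =>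
    rw [sum_range_succ, pre_succ, ← Nat.mod_add_mod]
    calc _ ≤ ((pre t k % m : ℕ) : K) * ((m : K) - (pre t k % m : ℕ)) + (t k : K) * ((m : K) - t k) :=
          mod_step_le (Nat.mod_lt _ hm) (ht k)
      _ ≤ _ := by linarith [ih]

/-- **Cross moments against the independent prefix variances**: for `i, j < n`,
`∑_R D_{i+1}D_{j+1} ≤ (1/m)·∑_{l ≤ min(i,j)} t_l(m − t_l)`. -/
theorem sum_disc_mul_disc_le_indep {m : ℕ} (hm : 0 < m) {t : ℕ → ℕ} (ht : ∀ i, t i ≤ m)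
    {n i j : ℕ} (hi : i < n) (hj : j < n) :
    ∑ R ∈ range m, disc K m t R (i + 1) * disc K m t R (j + 1)
      ≤ (∑ l ∈ range n, if l ≤ i ∧ l ≤ j then (t l : K) * ((m : K) - t l) else 0) / m := by
  have hm' : (0 : K) < m := by exact_mod_cast hm
  have hmK : (m : K) ≠ 0 := hm'.ne'
  have hP : ∀ p, p < n → (∀ l, (l ≤ i ∧ l ≤ j) ↔ l ≤ p) →
      (∑ l ∈ range n, if l ≤ i ∧ l ≤ j then (t l : K) * ((m : K) - t l) else 0)
        = ∑ l ∈ range (p + 1), (t l : K) * ((m : K) - t l) := by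
    intro p hp hiff
    rw [← sum_filter]
    congr 1
    ext l
    simp only [mem_filter, mem_range, hiff l]
    omega
  have hsq : ∀ p, ∑ R ∈ range m, (disc K m t R (p + 1)) ^ 2
      ≤ (∑ l ∈ range (p + 1), (t l : K) * ((m : K) - t l)) / m := by
    intro p
    rw [sum_disc_sq hm]
    exact div_le_div_of_nonneg_right (modvar_le_sum hm ht (p + 1)) hm'.le
  rcases le_total i j with h | h
  · rw [hP i hi (fun l => by omega)]
    exact (sum_disc_mul_disc_le_sq hm t (i + 1) (j + 1)).trans (hsq i)
  · rw [hP j hj (fun l => by omega)]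
    refine le_trans ?_ ((sum_disc_mul_disc_le_sq hm t (j + 1) (i + 1)).trans (hsq j))
    exact le_of_eq (sum_congr rfl fun R _ => mul_comm _ _)

/-! ### Assembly: dominance over independent SR -/

omit [LinearOrder K] [IsStrictOrderedRing K] in
/-- Rearrangement `∑ᵢⱼ aᵢaⱼ·∑_{l ≤ i, l ≤ j} f_l = ∑_l f_l·(∑_{i ≥ l} aᵢ)²`. -/
theorem double_sum_indicator (a f : ℕ → K) (n : ℕ) :
    ∑ i ∈ range n, ∑ j ∈ range n, a i * a j * (∑ l ∈ range n, if l ≤ i ∧ l ≤ j then f l else 0)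
      = ∑ l ∈ range n, f l * (∑ i ∈ range n, if l ≤ i then a i else 0) ^ 2 := by
  have e : ∀ i j, a i * a j * (∑ l ∈ range n, if l ≤ i ∧ l ≤ j then f l else 0)
      = ∑ l ∈ range n, f l * ((if l ≤ i then a i else 0) * (if l ≤ j then a j else 0)) := by
    intro i j
    rw [mul_sum]
    refine sum_congr rfl fun l _ => ?_
    by_cases hi : l ≤ i <;> by_cases hj : l ≤ j <;> simp [hi, hj, mul_comm, mul_left_comm]
  simp_rw [e]
  rw [sum_congr rfl fun i _ => sum_comm, sum_comm]
  refine sum_congr rfl fun l _ => ?_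
  rw [sq, sum_mul_sum, mul_sum]
  exact sum_congr rfl fun i _ => by rw [mul_sum]

omit [LinearOrder K] [IsStrictOrderedRing K] in
/-- Telescoping the Abel weights from `l` on: `∑_{l ≤ i < n} (Gᵢ − Gᵢ₊₁) = G_l` (`l < n`, `Gₙ := 0`). -/
theorem sum_indicator_gx (G : ℕ → K) {n l : ℕ} (hl : l < n) :
    ∑ i ∈ range n, (if l ≤ i then gx G n i - gx G n (i + 1) else 0) = G l := by
  rw [← sum_filter]
  have hf : (range n).filter (fun i => l ≤ i) = Ico l n := by
    ext i
    simp only [mem_filter, mem_range, mem_Ico]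
    omega
  rw [hf, sum_Ico_eq_sum_range,
    show ∑ k ∈ range (n - l), (gx G n (l + k) - gx G n (l + k + 1))
      = ∑ k ∈ range (n - l), ((fun k => gx G n (l + k)) k - (fun k => gx G n (l + k)) (k + 1))
      from rfl, Finset.sum_range_sub']
  simp [gx, hl, show l + (n - l) = n by omega]

/-- **DOMINANCE OVER INDEPENDENT SR.**  Gaps non-increasing along the block and nonnegative,
`θᵢ = tᵢ/m ≤ 1`: `∑_R e(R)² ≤ m·∑ᵢ Gᵢ²θᵢ(1−θᵢ)`, i.e. the prefix-scan block-sum MSE is at most the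
independent-SR block-sum MSE `V_ind` — for every block, on top of `E e² ≤ G₀²/4` (file LXIII). [new] -/
theorem sum_blockErr_sq_le_indep {m : ℕ} (hm : 0 < m) {t : ℕ → ℕ} (ht : ∀ i, t i ≤ m) {G : ℕ → K}
    {n : ℕ} (hmono : ∀ i, i + 1 < n → G (i + 1) ≤ G i) (hnn : ∀ i, 0 ≤ G i) :
    ∑ R ∈ range m, (blockErr m t G R n) ^ 2
      ≤ (m : K) * ∑ i ∈ range n, G i ^ 2 * ((t i : K) / m * (1 - (t i : K) / m)) := by
  have hm' : (0 : K) < m := by exact_mod_cast hm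
  have hmK : (m : K) ≠ 0 := hm'.ne'
  have ha : ∀ i ∈ range n, 0 ≤ gx G n i - gx G n (i + 1) :=
    fun i hi => gx_sub_nonneg hmono hnn i (mem_range.mp hi)
  have hexp : ∑ R ∈ range m, (blockErr m t G R n) ^ 2
      = ∑ i ∈ range n, ∑ j ∈ range n, (gx G n i - gx G n (i + 1)) * (gx G n j - gx G n (j + 1))
          * ∑ R ∈ range m, disc K m t R (i + 1) * disc K m t R (j + 1) := by
    rw [sum_congr rfl fun R hR => by rw [blockErr_eq_wsum t (mem_range.mp hR) G n, sq, sum_mul_sum],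
      sum_comm]
    refine sum_congr rfl fun i _ => ?_
    rw [sum_comm]
    refine sum_congr rfl fun j _ => ?_
    rw [mul_sum]
    exact sum_congr rfl fun R _ => by ring
  have hfin : ∑ i ∈ range n, ∑ j ∈ range n, (gx G n i - gx G n (i + 1)) * (gx G n j - gx G n (j + 1))
        * ((∑ l ∈ range n, if l ≤ i ∧ l ≤ j then (t l : K) * ((m : K) - t l) else 0) / m)
      = (m : K) * ∑ i ∈ range n, G i ^ 2 * ((t i : K) / m * (1 - (t i : K) / m)) := by
    have e1 : ∀ i j, (gx G n i - gx G n (i + 1)) * (gx G n j - gx G n (j + 1))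
        * ((∑ l ∈ range n, if l ≤ i ∧ l ≤ j then (t l : K) * ((m : K) - t l) else 0) / m)
        = (1 / (m : K)) * ((gx G n i - gx G n (i + 1)) * (gx G n j - gx G n (j + 1))
          * (∑ l ∈ range n, if l ≤ i ∧ l ≤ j then (t l : K) * ((m : K) - t l) else 0)) := by
      intro i j
      field_simp
    simp_rw [e1, ← mul_sum]
    rw [double_sum_indicator (fun i => gx G n i - gx G n (i + 1)) (fun l => (t l : K) * ((m : K) - t l)) n,
      sum_congr rfl fun l hl => by rw [sum_indicator_gx G (mem_range.mp hl)], mul_sum, mul_sum]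
    refine sum_congr rfl fun l _ => ?_
    field_simp
  rw [hexp, ← hfin]
  exact sum_le_sum fun i hi => sum_le_sum fun j hj =>
    mul_le_mul_of_nonneg_left (sum_disc_mul_disc_le_indep hm ht (mem_range.mp hi) (mem_range.mp hj))
      (mul_nonneg (ha i hi) (ha j hj))

/-- **Both `n`-free and never worse**: `E e² ≤ min(G₀²/4, V_ind)` (files LXIII + LXV). -/
theorem sum_blockErr_sq_le_min {m : ℕ} (hm : 0 < m) {t : ℕ → ℕ} (ht : ∀ i, t i ≤ m) {G : ℕ → K}
    {n : ℕ} (hmono : ∀ i, i + 1 < n → G (i + 1) ≤ G i) (hnn : ∀ i, 0 ≤ G i) :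
    ∑ R ∈ range m, (blockErr m t G R n) ^ 2
      ≤ min ((m : K) * G 0 ^ 2 / 4)
          ((m : K) * ∑ i ∈ range n, G i ^ 2 * ((t i : K) / m * (1 - (t i : K) / m))) :=
  le_min (sum_blockErr_sq_le hm t hmono hnn) (sum_blockErr_sq_le_indep hm ht hmono hnn)

end Value

end Coupled

/-! ### FP4 ledger -/

namespace FP4

open Coupled

/-- **E2M1 block `(11/2, 13/4, 5/2, 9/8)`, `N = 2` (file LXIII): `∑_R e² = 43/16 ≤ 79/16 = 4·V_ind`;
and the near-tie of the gen13 certificate: gaps `(4, 1/16, 1/16)` at `θ ≡ 1/2`, `N = 1`, where the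
coupled errors are `∓2` (`E e² = 4`) against `V_ind = 4 + 1/512`.** -/
theorem dominance_witness :
    (∑ R ∈ range 4, (blockErr 4 blkT blkG R 4) ^ 2 = 43 / 16) ∧
    ((4 : ℚ) * ∑ i ∈ range 4, blkG i ^ 2 * ((blkT i : ℚ) / 4 * (1 - (blkT i : ℚ) / 4)) = 79 / 16) ∧
    (∀ R < 2, blockErr 2 (fun _ => 1)
        (fun i => if i = 0 then (4 : ℚ) else if i < 3 then 1 / 16 else 0) R 3 = if R = 0 then -2 else 2) ∧
    ((2 : ℚ) * ((4 : ℚ) ^ 2 * (1 / 2 * (1 - 1 / 2)) + 2 * ((1 / 16) ^ 2 * (1 / 2 * (1 - 1 / 2))))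
        = 2 * (4 + 1 / 512)) := by
  refine ⟨?_, ?_, ?_, by norm_num⟩
  · simp only [sum_range_succ, sum_range_zero, blockErr, sysUp, cnt, pre, blkT, blkG]
    norm_num
  · simp only [sum_range_succ, sum_range_zero, blkT, blkG]
    norm_num
  · intro R hR
    interval_cases R <;>
      · simp only [sum_range_succ, sum_range_zero, blockErr, sysUp, cnt, pre]; norm_num

end FP4

end Summit.Ventures.CertifiedArithmetic.LowPrec.SR
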